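import Mathlib
import HarnessLib.Audit
import Summits.PneNP.PneNP.Theorems.PstarCrossData
import Summits.PneNP.PneNP.Theorems.PstarSlotSwap

/-!
# The blind free CROSS gate: `CrossCount ⟹ TerminalFiveCross1BlindOr` in all four orientations (O2 / E1; prover-1 g22)

FRONTIER range-avoidance ladder, rung F-N3 (`stmt-PneNP-19007`), cell `pnp-ideate`; restricted-model proof complexity — nothing here bears on `P` versus `NP`.

`PstarCrossData.crossData_of_terminal` packages the raw hypotheses of `PstarCrossBlind.TerminalFiveCross1BlindOr` into `CrossData` when the gate's first
variable is the FIRST AND slot of its chord `e_p` and the gate's second variable the first AND slot of `e_q`.  The other three orientations are instance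
symmetries: `PstarSlotSwap.swapAnd I e` exchanges the AND slots of one output and preserves purity, typing, simple overlaps, expansion, `Terminal`,
peelability, chords, privates and `gval`.  This file bundles the raw hypotheses (`RawCross`), transports them along the swap of a co-chord
(`rawCross_swapAnd`; the touched-chord set is invariant, `touchedBy_swapAnd`), and concludes
**`cross1BlindOr_of_crossCount : CrossCount → TerminalFiveCross1BlindOr`**.  So the E1 residue of O2 is the single bridge-level node `CrossCount`.
-/

set_option linter.dupNamespace false -- `Summit.PneNP.PneNP.…`: summit = sub-problem name (D-0017 single-conjunct layout)

open Finset Literature.Computability.Complexity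
open Summit.PneNP.PneNP.Theorems.PstarTyped (Typed)
open Summit.PneNP.PneNP.Theorems.PstarSALevel (varSet bdry BoundaryExpanding SimpleOverlap)
open Summit.PneNP.PneNP.Theorems.PstarCentreFree (vars_mem_varSet)
open Summit.PneNP.PneNP.Theorems.PstarGapOneAll (gval)
open Summit.PneNP.PneNP.Theorems.PstarChordRepair (IsChord)
open Summit.PneNP.PneNP.Theorems.PstarChordBridgeTools (privs mem_privs)
open Summit.PneNP.PneNP.Theorems.PstarChordBridgeCotree (Peelable)
open Summit.PneNP.PneNP.Theorems.PstarCoreBoundTargets (Terminal)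
open Summit.PneNP.PneNP.Theorems.PstarUnion (SatPair)
open Summit.PneNP.PneNP.Theorems.PstarCross (CrossGate)
open Summit.PneNP.PneNP.Theorems.PstarCross2 (touchedBy)
open Summit.PneNP.PneNP.Theorems.PstarCrossBlind (TerminalFiveCross1BlindOr)
open Summit.PneNP.PneNP.Theorems.PstarSlotSwap
open Summit.PneNP.PneNP.Theorems.PstarCrossData (CrossCount crossData_of_terminal)

namespace Summit.PneNP.PneNP.Theorems.PstarCrossLink

variable {n m : ℕ}

/-! ## The raw hypotheses and their transport -/

/-- The hypotheses of `TerminalFiveCross1BlindOr` after the instance parameters, bundled (so that they can be transported along AND-slot swaps). -/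
structure RawCross (I : LocalMap 4 n m) (r : ℕ) (y : Fin m → Bool) (J₀ : Finset (Fin m)) (w₁ w₂ : Finset (Fin n) × Finset (Fin m) × Bool)
    (F : Finset (Fin m)) (g₀ : Fin m) : Prop where
  /-- the terminal pair -/
  term : Terminal I r y J₀ w₁ w₂
  /-- `F ⊆ J₀` -/
  sub : F ⊆ J₀
  /-- `F` peelable -/
  peel : Peelable I F
  /-- `F` maximal peelable -/
  max : ∀ F', F ⊆ F' → F' ⊆ J₀ → Peelable I F' → F' = F
  /-- co-edges are chords -/
  chord : ∀ e ∈ J₀ \ F, IsChord I J₀ e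
  /-- the gate is a monomial of `w₁` -/
  gate : g₀ ∈ w₁.2.1
  /-- the gate is cross -/
  cross : CrossGate I J₀ F g₀
  /-- every other monomial is hun-clean -/
  hun : ∀ g ∈ (w₁.2.1.erase g₀) ∪ w₂.2.1, ∀ v ∈ privs I (J₀ \ F), I.vars g 2 ≠ v ∧ I.vars g 3 ≠ v
  /-- the first gate variable is free on `Z` -/
  free₂ : ∀ c : Bool, SatPair I y J₀ (({I.vars g₀ 2} : Finset (Fin n)), (∅ : Finset (Fin m)), c) w₂
  /-- the second gate variable is free on `Z` -/
  free₃ : ∀ c : Bool, SatPair I y J₀ (({I.vars g₀ 3} : Finset (Fin n)), (∅ : Finset (Fin m)), c) w₂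
  /-- `w₂` is blind to the privates of the touched chords -/
  blind : ∀ e ∈ touchedBy I J₀ F g₀, I.vars e 2 ∉ w₂.1 ∧ I.vars e 3 ∉ w₂.1
  /-- OR shape: `p ∈ w₁.1` -/
  memC₂ : I.vars g₀ 2 ∈ w₁.1
  /-- OR shape: `q ∈ w₁.1` -/
  memC₃ : I.vars g₀ 3 ∈ w₁.1
  /-- OR shape: the mates are unread -/
  mates : ∀ e ∈ touchedBy I J₀ F g₀, ∀ s : Fin 4, 2 ≤ s.val → I.vars e s ≠ I.vars g₀ 2 → I.vars e s ≠ I.vars g₀ 3 → I.vars e s ∉ w₁.1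
  /-- `x_p ∨ x_q ≡ 1` on `Z` -/
  or_on_Z : ∀ z : Fin n → Bool, (∀ j ∈ J₀, I.eval z j = y j) → gval I w₂.1 w₂.2.1 z = w₂.2.2 → z (I.vars g₀ 2) = true ∨ z (I.vars g₀ 3) = true

/-- Orientation `(2, 2)`: `CrossCount` bounds the core. -/
theorem card_le_five_of_raw₂₂ (hC : CrossCount) (I : LocalMap 4 n m) (hI : I.IsPure xorAndPred) (hT : Typed I) (hS : SimpleOverlap I) {r : ℕ}
    (hB : BoundaryExpanding r I) {y : Fin m → Bool} {J₀ : Finset (Fin m)} {w₁ w₂ : Finset (Fin n) × Finset (Fin m) × Bool} {F : Finset (Fin m)}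
    {g₀ : Fin m} (h : RawCross I r y J₀ w₁ w₂ F g₀) {e_p e_q : Fin m} (hep : e_p ∈ J₀ \ F) (heq : e_q ∈ J₀ \ F)
    (hgp : I.vars g₀ 2 = I.vars e_p 2) (hgq : I.vars g₀ 3 = I.vars e_q 2) : J₀.card ≤ 5 := by
  obtain ⟨B, hJ, -, -, -, -, -, -, -, -, hD⟩ := crossData_of_terminal I hI hT hS hB h.term h.sub h.peel h.max h.chord h.gate hep heq hgp hgq h.hun
    h.free₂ h.free₃ h.blind h.memC₂ h.memC₃ h.mates h.or_on_Z
  rw [← hJ]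
  exact hC n m r I hI hT hS hB B e_p e_q g₀ hD

/-- The touched chords do not depend on the AND-slot order of a core output. -/
theorem touchedBy_swapAnd (I : LocalMap 4 n m) {J₀ F : Finset (Fin m)} {e g₀ : Fin m} (he : g₀ ≠ e) :
    touchedBy (swapAnd I e) J₀ F g₀ = touchedBy I J₀ F g₀ := by
  unfold PstarCross2.touchedBy
  refine filter_congr fun e' _ => ?_
  rw [swapAnd_vars_of_ne I he, swapAnd_vars_of_ne I he]
  by_cases h : e' = e
  · subst h
    rw [(swapAnd_vars_two I e').1, (swapAnd_vars_two I e').2]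
    constructor
    · rintro (h | h | h | h)
      · exact Or.inr (Or.inl h)
      · exact Or.inl h
      · exact Or.inr (Or.inr (Or.inr h))
      · exact Or.inr (Or.inr (Or.inl h))
    · rintro (h | h | h | h)
      · exact Or.inr (Or.inl h)
      · exact Or.inl h
      · exact Or.inr (Or.inr (Or.inr h))
      · exact Or.inr (Or.inr (Or.inl h))
  · rw [swapAnd_vars_of_ne I h, swapAnd_vars_of_ne I h]

/-- **Transport along the AND-slot swap of a co-chord**: the raw hypotheses for `I` give the raw hypotheses for `swapAnd I e` (`e ∈ J₀ ∖ F`). -/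
theorem rawCross_swapAnd {I : LocalMap 4 n m} (hI : I.IsPure xorAndPred) {r : ℕ} {y : Fin m → Bool} {J₀ : Finset (Fin m)}
    {w₁ w₂ : Finset (Fin n) × Finset (Fin m) × Bool} {F : Finset (Fin m)} {g₀ : Fin m} (h : RawCross I r y J₀ w₁ w₂ F g₀)
    {e : Fin m} (he : e ∈ J₀ \ F) : RawCross (swapAnd I e) r y J₀ w₁ w₂ F g₀ := by
  classical
  obtain ⟨-, -, -, hd₁, hd₂, -⟩ := id h.term
  have heJ : e ∈ J₀ := (mem_sdiff.1 he).1
  have hg₀e : g₀ ≠ e := fun hh => disjoint_left.1 hd₁ heJ (hh ▸ h.gate)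
  have hvo : ∀ {j : Fin m}, j ≠ e → ∀ s, (swapAnd I e).vars j s = I.vars j s := fun hj s => swapAnd_vars_of_ne I hj s
  have hmono : ∀ g ∈ (w₁.2.1.erase g₀) ∪ w₂.2.1, g ≠ e := by
    intro g hg hh
    rcases mem_union.1 hg with hg | hg
    · exact disjoint_left.1 hd₁ heJ (hh ▸ mem_of_mem_erase hg)
    · exact disjoint_left.1 hd₂ heJ (hh ▸ hg)
  have hsat : ∀ (v : Fin n) (c : Bool), SatPair I y J₀ (({v} : Finset (Fin n)), (∅ : Finset (Fin m)), c) w₂ →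
      SatPair (swapAnd I e) y J₀ (({v} : Finset (Fin n)), (∅ : Finset (Fin m)), c) w₂ := by
    intro v c ⟨x, hx, h1, h2'⟩
    refine ⟨x, fun j hj => by rw [eval_swapAnd hI]; exact hx j hj, ?_, ?_⟩
    · have : gval (swapAnd I e) {v} ∅ x = gval I {v} ∅ x := gval_swapAnd I e _ _ x
      exact this.trans h1
    · rw [gval_swapAnd]; exact h2'
  exact
    { term := (terminal_swapAnd hI e r y J₀ w₁ w₂).2 h.term
      sub := h.sub
      peel := (peelable_swapAnd I e F).2 h.peel
      max := fun F' h1 h2 h3 => h.max F' h1 h2 ((peelable_swapAnd I e F').1 h3)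
      chord := fun e' he' => (isChord_swapAnd I e J₀ e').2 (h.chord e' he')
      gate := h.gate
      cross := by
        obtain ⟨h2, h3⟩ := h.cross
        refine ⟨?_, ?_⟩
        · rw [hvo hg₀e, privs_swapAnd]; exact h2
        · rw [hvo hg₀e, privs_swapAnd]; exact h3
      hun := fun g hg v hv => by
        rw [privs_swapAnd] at hv
        rw [hvo (hmono g hg), hvo (hmono g hg)]
        exact h.hun g hg v hv
      free₂ := fun c => by rw [hvo hg₀e]; exact hsat _ c (h.free₂ c)
      free₃ := fun c => by rw [hvo hg₀e]; exact hsat _ c (h.free₃ c)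
      blind := fun e' he' => by
        rw [touchedBy_swapAnd I hg₀e] at he'
        by_cases hee : e' = e
        · subst hee
          rw [(swapAnd_vars_two I e').1, (swapAnd_vars_two I e').2]
          exact (h.blind e' he').symm
        · rw [hvo hee, hvo hee]; exact h.blind e' he'
      memC₂ := by rw [hvo hg₀e]; exact h.memC₂
      memC₃ := by rw [hvo hg₀e]; exact h.memC₃
      mates := fun e' he' s hs => by
        rw [touchedBy_swapAnd I hg₀e] at he'
        rw [hvo hg₀e, hvo hg₀e, swapAnd_vars]
        by_cases hee : e' = e
        · rw [if_pos hee]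
          exact h.mates e' he' (σ s) ((two_le_σ_iff s).2 hs)
        · rw [if_neg hee]
          exact h.mates e' he' s hs
      or_on_Z := fun z hz hzw => by
        rw [hvo hg₀e, hvo hg₀e]
        refine h.or_on_Z z (fun j hj => ?_) ?_
        · rw [← eval_swapAnd hI e]; exact hz j hj
        · rw [← gval_swapAnd I e]; exact hzw }

/-- AND slots are `2` or `3`. -/
private theorem slot_cases {s : Fin 4} (hs : 2 ≤ s.val) : s = 2 ∨ s = 3 := by
  rcases s with ⟨_ | _ | _ | _ | k, hk⟩
  · exact absurd hs (by simp)
  · exact absurd hs (by simp)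
  · exact Or.inl rfl
  · exact Or.inr rfl
  · omega

/-- `CrossCount` bounds the core from the raw hypotheses, for the chord of `q` in either slot (orientation of `p` already `2`). -/
theorem card_le_five_of_raw₂ (hC : CrossCount) (I : LocalMap 4 n m) (hI : I.IsPure xorAndPred) (hT : Typed I) (hS : SimpleOverlap I) {r : ℕ}
    (hB : BoundaryExpanding r I) {y : Fin m → Bool} {J₀ : Finset (Fin m)} {w₁ w₂ : Finset (Fin n) × Finset (Fin m) × Bool} {F : Finset (Fin m)}
    {g₀ : Fin m} (h : RawCross I r y J₀ w₁ w₂ F g₀) {e_p e_q : Fin m} (hep : e_p ∈ J₀ \ F) (heq : e_q ∈ J₀ \ F)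
    (hgp : I.vars g₀ 2 = I.vars e_p 2) {s : Fin 4} (hs : 2 ≤ s.val) (hgq : I.vars g₀ 3 = I.vars e_q s) : J₀.card ≤ 5 := by
  rcases slot_cases hs with rfl | rfl
  · exact card_le_five_of_raw₂₂ hC I hI hT hS hB h hep heq hgp hgq
  · -- swap the AND slots of `e_q`
    obtain ⟨-, -, -, hd₁, -⟩ := id h.term
    have hg₀e : g₀ ≠ e_q := fun hh => disjoint_left.1 hd₁ (mem_sdiff.1 heq).1 (hh ▸ h.gate)
    have hne : e_p ≠ e_q := by
      -- `vars e_p 2 = vars g₀ 2` and `vars e_q 3 = vars g₀ 3`; if `e_p = e_q` then `g₀` meets it in two variables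
      intro hh
      subst hh
      have hg₀J : g₀ ∉ J₀ := fun hh => disjoint_left.1 hd₁ hh h.gate
      have h2v : I.vars g₀ 2 ∈ varSet I g₀ ∩ varSet I e_p := mem_inter.2 ⟨vars_mem_varSet I g₀ 2, hgp ▸ vars_mem_varSet I e_p 2⟩
      have h3v : I.vars g₀ 3 ∈ varSet I g₀ ∩ varSet I e_p := mem_inter.2 ⟨vars_mem_varSet I g₀ 3, hgq ▸ vars_mem_varSet I e_p 3⟩
      have hpq : I.vars g₀ 2 ≠ I.vars g₀ 3 := fun hh => absurd (hI.2 g₀ hh) (by decide)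
      exact hpq (card_le_one.1 (hS g₀ e_p fun hh => hg₀J (hh ▸ (mem_sdiff.1 hep).1)) _ h2v _ h3v)
    refine card_le_five_of_raw₂₂ hC (swapAnd I e_q) (isPure_swapAnd hI e_q) (typed_swapAnd hT e_q) (simpleOverlap_swapAnd hS e_q)
      (boundaryExpanding_swapAnd hB e_q) (rawCross_swapAnd hI h heq) hep heq ?_ ?_
    · rw [swapAnd_vars_of_ne I hg₀e, swapAnd_vars_of_ne I hne]; exact hgp
    · rw [swapAnd_vars_of_ne I hg₀e, (swapAnd_vars_two I e_q).1]; exact hgq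

/-- **`CrossCount ⟹ TerminalFiveCross1BlindOr`** (all four orientations of the gate's two privates). -/
theorem cross1BlindOr_of_crossCount (hC : CrossCount) : TerminalFiveCross1BlindOr := by
  intro n m r I hI hT hS hB y J₀ w₁ w₂ ht F hF hP hmax hch g₀ hg₀ hcg hun h2 h3 hbl hpC hqC hmates hZor
  classical
  have h : RawCross I r y J₀ w₁ w₂ F g₀ := ⟨ht, hF, hP, hmax, hch, hg₀, hcg, hun, h2, h3, hbl, hpC, hqC, hmates, hZor⟩
  obtain ⟨e_p, hep, hp⟩ := (mem_privs I).1 hcg.1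
  obtain ⟨e_q, heq, hq⟩ := (mem_privs I).1 hcg.2
  have hq' : ∃ s : Fin 4, 2 ≤ s.val ∧ I.vars g₀ 3 = I.vars e_q s := by
    rcases hq with hq | hq
    · exact ⟨2, by decide, hq.symm⟩
    · exact ⟨3, by decide, hq.symm⟩
  obtain ⟨s, hs, hgq⟩ := hq'
  rcases hp with hp | hp
  · exact card_le_five_of_raw₂ hC I hI hT hS hB h hep heq hp.symm hs hgq
  · -- swap the AND slots of `e_p`
    obtain ⟨-, -, -, hd₁, -⟩ := id ht
    have hg₀e : g₀ ≠ e_p := fun hh => disjoint_left.1 hd₁ (mem_sdiff.1 hep).1 (hh ▸ hg₀)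
    by_cases hne : e_q = e_p
    · -- then `q` is the other private of `e_p`: `g₀` meets `e_p` twice
      subst hne
      exfalso
      have hg₀J : g₀ ∉ J₀ := fun hh => disjoint_left.1 hd₁ hh hg₀
      have h2v : I.vars g₀ 2 ∈ varSet I g₀ ∩ varSet I e_q := mem_inter.2 ⟨vars_mem_varSet I g₀ 2, hp ▸ vars_mem_varSet I e_q 3⟩
      have h3v : I.vars g₀ 3 ∈ varSet I g₀ ∩ varSet I e_q := mem_inter.2 ⟨vars_mem_varSet I g₀ 3, hgq ▸ vars_mem_varSet I e_q s⟩
      have hpq : I.vars g₀ 2 ≠ I.vars g₀ 3 := fun hh => absurd (hI.2 g₀ hh) (by decide)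
      exact hpq (card_le_one.1 (hS g₀ e_q fun hh => hg₀J (hh ▸ (mem_sdiff.1 hep).1)) _ h2v _ h3v)
    · refine card_le_five_of_raw₂ hC (swapAnd I e_p) (isPure_swapAnd hI e_p) (typed_swapAnd hT e_p) (simpleOverlap_swapAnd hS e_p)
        (boundaryExpanding_swapAnd hB e_p) (rawCross_swapAnd hI h hep) hep heq ?_ hs ?_
      · rw [swapAnd_vars_of_ne I hg₀e, (swapAnd_vars_two I e_p).1]; exact hp.symm
      · rw [swapAnd_vars_of_ne I hg₀e, swapAnd_vars_of_ne I hne]; exact hgq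

end Summit.PneNP.PneNP.Theorems.PstarCrossLink
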